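import Summits.HodgeConjecture.HodgeConjecture.Theorems.Ring2WeilCoverageWeilGramCMPoint
import Summits.HodgeConjecture.HodgeConjecture.Theorems.Ring2WeilCoverageRamifiedTypesLevel15
import Summits.HodgeConjecture.HodgeConjecture.Theorems.Ring2WeilCoverageRealUnitNormHalfSystems
import Summits.HodgeConjecture.HodgeConjecture.Theorems.Ring2WeilCoverageNormTable
import Mathlib.Tactic.ComputeDegree
import HarnessLib

/-!
# Weil-type family coverage — THE COMPONENTS OF THE WEIL-TYPE `ℤ[ζ₁₅]`-FOURFOLDS, I: the real frame
# `1, θ, θ², θ³` (`θ = ζ + ζ⁻¹`) of `ℚ(ζ₁₅)⁺` and van Geemen's Gram determinant of the PRINCIPAL-type form `E_ξ` for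
# `K_d = ℚ(√−3)`: `det a = −144 = −12²`, class `[−1]` — the wrong sign for Weil signature `(2, 2)`

research route conditional on HC_CM; not a corollary; Q11.4-sentence-2 already refuted in dim ≥ 3.

Ring 2, WEIL-TYPE FAMILY-COVERAGE CENSUS (`HOME/WEIL-FAMILY-COVERAGE.md` `## b01`, blocks b01.41 (C), b01.46 (C2)/(E)
«NOT CLAIMED: the component placements … (S-pencil)», owner ring2-b01), part 83 of the `Ring2WeilCoverage*` series:
the level-`15` numbers for part 82 (`Ring2WeilCoverageWeilGramCMPoint`).  `K = ℚ(ζ₁₅)` (`g = 4`), the census's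
principal-type parameter `ξ = ζ³/Φ₁₅′(ζ)` (part 6′ `isOfType_one_xi_top`, part 7 `complexConj_xi`), `s₃ = 1 + 2ζ⁵`
(`s₃² = −3`, skew: `ℚ(s₃) = ℚ(√−3) ⊂ K`), `s₁₅ = s₃·(1 + 2(ζ³ + ζ¹²))` (`s₁₅² = −15`), and the REAL FRAME `xᵢ = θ^i`,
`θ = ζ + ζ⁻¹`, `i < 4` (§3: a `ℚ`-basis of `K⁺`, hence `{xᵢ, s xᵢ}` a `ℚ`-basis of `K` by part 82
`linearIndependent_realFrame` — a `K_d`-frame in the sense of [vG94 Lemma 5.2 (3)]).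

* §0 level lemmas (`Φ₁₅(ζ) = 0` written out, `θζ = ζ² + 1`, realness / skewness, squares) and the evaluation step
  `trace_of_key`: `Tr_{K/ℚ}(y θ^m) = coeff₇(R)` from a certificate `y(ζ² + 1)^m = R(ζ)Φ₁₅′(ζ)⁻¹ζ^m` (part 81).
* §1 the seven traces `Tr(ξ s₃ θ^m)`, `m ≤ 6`, hence (part 82 `ha_eq`) the Gram datum of `(E_ξ, s₃)` in the frame:
  `b = 0` and **`a = −(2,4,4,12 / 4,4,12,10 / 4,12,10,38 / 12,10,38,26)`, `det a = −144`**.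
* §3 `1, θ, θ², θ³` is a `ℚ`-basis of `K⁺` (independence from the Hankel system of §1; `[K⁺:ℚ] = 4`).
* §4 **for EVERY skew `ζ′` of PRINCIPAL type on `ℤ[ζ₁₅]` (`IsOfType 1 ζ′ ⊤`) the Gram determinant of `(E_ζ′, s₃)` in the
  frame `θ^i` is `−144`** (part 82 `det_realPart_eq_of_isOfType` + THEOREM L (i) at `15`, part 67); its class in
  `ℚˣ/Nm(ℚ(√−3)ˣ)` is `[−1] ≠ [1]`; and `(−1)² det a < 0` is the WRONG SIGN: by [vG94 Lemma 5.2 (4)] (quoted, not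
  re-proved) a polarised abelian fourfold of Weil type has `(−1)ⁿ det H > 0`, so no principal-type `E_ζ′` polarises a
  `ℚ(√−3)`-balanced CM type — the census NO row `(15, √−3)` (part 75 `not_exists_principal_fifteen_sqrt_neg_three`)
  re-read from a determinant.  Parts 84/85: the types `𝔮₅`, `𝔮₃` and `K_d = ℚ(√−15)`.

HONEST FRAMING: statements about traces in `ℚ(ζ₁₅)` and the rational Gram matrices `(a, b)` of part 82 (identified
there, §5, with Shimura's `E_ζ′` on `ℂ^Φ` for every CM type `Φ`); nothing about Hodge classes, `W_K`, general members
or HC; `HC_CM` is used nowhere.  No `def`, no named fact, no `sorry`.  The certificates (`R`, `Q₁`, `Q₂` with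
`ζ^m·ζ′sθ^m·Φ₁₅′ = R + Q₁Φ₁₅ + Q₂(ζ¹⁵ − 1)`) come from exact arithmetic in `ℚ[x]/Φ₁₅` (session `work/py/gen15.py`)
and are re-verified by `linear_combination`.

References: [cite: vanGeemen1994HodgeAV, Lemma 5.2 (2)–(4), 5.4 and (5.4.1)]; [cite: Shimura1998, §6.2 Thm. 4 and
§14.3 Prop. 4–5, pp. 44–45, 103–104]; census b01.41 (C), b01.46 (C2) (seat-derived).
-/

noncomputable section

open Polynomial NumberField Module
open scoped nonZeroDivisors

namespace Summit.HodgeConjecture.Ring2WeilCoverage.WeilGramLevel15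

open Literature.AlgebraicGeometry.VanGeemen1994 (weilField weilNormResidueGroup)
open Literature.AlgebraicGeometry.Motives (normUnitsSubgroup)
open Literature.NumberTheory.ComplexMultiplication
open Summit.HodgeConjecture.Ring2WeilCoverage.TraceGramDeterminant (trace_aeval_zeta_mul_inv)
open Summit.HodgeConjecture.Ring2WeilCoverage.WeilGramCMPoint
open Summit.HodgeConjecture.Ring2WeilCoverage.RealUnitNormHalfSystems (complexConj_eq_inv)
open Summit.HodgeConjecture.Ring2WeilCoverage.CyclotomicPrincipalObstruction (complexConj_xi)
open Summit.HodgeConjecture.Ring2WeilCoverage.CyclotomicDifferent (isOfType_one_xi_top xi_ne_zero)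
open Summit.HodgeConjecture.Ring2WeilCoverage.RealUnitNormAllLevels (norm_realUnits_pos_fifteen)
open Summit.HodgeConjecture.HodgeConjecture.Ring2.WeilCoverage (mk_ne_split_of_even not_mem_normUnitsSubgroup_of_not_exists
  mem_normUnitsSubgroup_of_sq_add_mul_sq)
open Summit.HodgeConjecture.HodgeConjecture.Ring2.Hypotheses (splitDiscriminantClass)

variable {K : Type} [Field K] [NumberField K] {ζ : K}

/-! ### §0 Level lemmas -/

/-- `φ(15) = 8`. [folklore] -/
theorem totient_fifteen : Nat.totient 15 = 8 := by decide

omit [NumberField K] in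
/-- **`Φ₁₅(ζ) = 0` written out**: `ζ⁸ − ζ⁷ + ζ⁵ − ζ⁴ + ζ³ − ζ + 1 = 0` (`(x⁵ − 1)(x³ − 1)Φ₁₅(x) = (x¹⁵ − 1)(x − 1)` and
`ζ⁵, ζ³ ≠ 1`).
research route conditional on HC_CM; not a corollary; Q11.4-sentence-2 already refuted in dim ≥ 3. [folklore] -/
theorem cyc_fifteen (hζ : IsPrimitiveRoot ζ 15) : ζ ^ 8 - ζ ^ 7 + ζ ^ 5 - ζ ^ 4 + ζ ^ 3 - ζ + 1 = 0 := by
  have h15 : ζ ^ 15 = 1 := hζ.pow_eq_one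
  have h5 : ζ ^ 5 - 1 ≠ 0 := sub_ne_zero.mpr (hζ.pow_ne_one_of_pos_of_lt (by norm_num) (by norm_num))
  have h3 : ζ ^ 3 - 1 ≠ 0 := sub_ne_zero.mpr (hζ.pow_ne_one_of_pos_of_lt (by norm_num) (by norm_num))
  have h : (ζ ^ 5 - 1) * (ζ ^ 3 - 1) * (ζ ^ 8 - ζ ^ 7 + ζ ^ 5 - ζ ^ 4 + ζ ^ 3 - ζ + 1) = 0 := by
    linear_combination (ζ - 1) * h15
  rcases mul_eq_zero.mp h with h' | h'
  · exact absurd h' (mul_ne_zero h5 h3)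
  · exact h'

omit [NumberField K] in
/-- `θζ = ζ² + 1` for `θ = ζ + ζ⁻¹`. [folklore] -/
theorem theta_mul_zeta (hζ : IsPrimitiveRoot ζ 15) : (ζ + ζ⁻¹) * ζ = ζ ^ 2 + 1 := by
  have hζ0 : ζ ≠ 0 := hζ.ne_zero (by norm_num)
  rw [add_mul, inv_mul_cancel₀ hζ0]
  ring

omit [NumberField K] in
/-- `(ζ⁻¹)^a = ζ^b` when `a + b = 15`. [folklore] -/
theorem inv_pow_eq_pow (hζ : IsPrimitiveRoot ζ 15) {a b : ℕ} (hab : a + b = 15) : ζ⁻¹ ^ a = ζ ^ b := by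
  have hζ0 : ζ ≠ 0 := hζ.ne_zero (by norm_num)
  rw [inv_pow]
  apply inv_eq_of_mul_eq_one_right
  rw [← pow_add, hab, hζ.pow_eq_one]

/-- `θ = ζ + ζ⁻¹` is real. [folklore] -/
theorem complexConj_theta [IsCMField K] (hζ : IsPrimitiveRoot ζ 15) :
    IsCMField.complexConj K (ζ + ζ⁻¹) = ζ + ζ⁻¹ := by
  rw [map_add, map_inv₀, complexConj_eq_inv hζ, inv_inv, add_comm]

/-- The frame `xᵢ = θ^i` is real. [folklore] -/
theorem complexConj_thetaFrame [IsCMField K] (hζ : IsPrimitiveRoot ζ 15) {m : ℕ} {x : Fin m → K}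
    (hx : ∀ i, x i = (ζ + ζ⁻¹) ^ (i : ℕ)) (i : Fin m) : IsCMField.complexConj K (x i) = x i := by
  rw [hx i, map_pow, complexConj_theta hζ]

omit [NumberField K] in
/-- **`s₃² = −3`** for `s₃ = 1 + 2ζ⁵` (`ζ⁵` is a primitive cube root of unity). [folklore] -/
theorem sq_sqrtNegThree (hζ : IsPrimitiveRoot ζ 15) : (1 + 2 * ζ ^ 5) ^ 2 = -3 := by
  have h15 : ζ ^ 15 = 1 := hζ.pow_eq_one
  have h5 : ζ ^ 5 - 1 ≠ 0 := sub_ne_zero.mpr (hζ.pow_ne_one_of_pos_of_lt (by norm_num) (by norm_num))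
  have h : (ζ ^ 5 - 1) * ((1 + 2 * ζ ^ 5) ^ 2 + 3) = 0 := by linear_combination (4 : K) * h15
  rcases mul_eq_zero.mp h with h' | h'
  · exact absurd h' h5
  · exact eq_neg_of_add_eq_zero_left h'

/-- **`s₃` is skew**: `(1 + 2ζ⁵)^ρ = −(1 + 2ζ⁵)` (`ζ¹⁰ + ζ⁵ + 1 = 0`). [folklore] -/
theorem complexConj_sqrtNegThree [IsCMField K] (hζ : IsPrimitiveRoot ζ 15) :
    IsCMField.complexConj K (1 + 2 * ζ ^ 5) = -(1 + 2 * ζ ^ 5) := by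
  have h15 : ζ ^ 15 = 1 := hζ.pow_eq_one
  have h5 : ζ ^ 5 - 1 ≠ 0 := sub_ne_zero.mpr (hζ.pow_ne_one_of_pos_of_lt (by norm_num) (by norm_num))
  have h10 : ζ ^ 10 + ζ ^ 5 + 1 = 0 := by
    have h : (ζ ^ 5 - 1) * (ζ ^ 10 + ζ ^ 5 + 1) = 0 := by linear_combination h15
    rcases mul_eq_zero.mp h with h' | h'
    · exact absurd h' h5
    · exact h'
  rw [map_add, map_mul, map_pow, complexConj_eq_inv hζ, map_one, map_ofNat,
    inv_pow_eq_pow hζ (show 5 + 10 = 15 by norm_num)]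
  linear_combination (2 : K) * h10

/-- `ξ = ζ³/Φ₁₅′(ζ)` is skew (part 7, `g − 1 = 3`). [folklore] -/
theorem complexConj_xi_fifteen [IsCMField K] (hζ : IsPrimitiveRoot ζ 15) :
    IsCMField.complexConj K (ζ ^ 3 * (aeval ζ (derivative (cyclotomic 15 ℚ)))⁻¹) =
      -(ζ ^ 3 * (aeval ζ (derivative (cyclotomic 15 ℚ)))⁻¹) :=
  complexConj_xi hζ (k := 3) (by rw [totient_fifteen])

/-! ### §0b The evaluation step: `Tr(y·θ^m)` from a certificate `y(ζ² + 1)^m = R(ζ)Φ₁₅′(ζ)⁻¹ζ^m` -/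

/-- `Tr_{K/ℚ}(y) = coeff₇(R)` if `y = R(ζ)/Φ₁₅′(ζ)` with `deg R ≤ 7` (part 81 `trace_aeval_zeta_mul_inv`).
HFMARK [folklore] -/
theorem trace_of_key₀ [IsCyclotomicExtension {15} ℚ K] (hζ : IsPrimitiveRoot ζ 15) {y : K} (R : ℚ[X])
    (hR : R.natDegree ≤ 7) (hkey : y = aeval ζ R * (aeval ζ (derivative (cyclotomic 15 ℚ)))⁻¹) :
    Algebra.trace ℚ K y = R.coeff 7 := by
  rw [hkey, trace_aeval_zeta_mul_inv hζ R (by rw [totient_fifteen]; omega), totient_fifteen]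

/-- `Tr_{K/ℚ}(y·θ) = coeff₇(R)` if `y(ζ² + 1) = R(ζ)Φ₁₅′(ζ)⁻¹·ζ` (`θζ = ζ² + 1`).
HFMARK [folklore] -/
theorem trace_of_key₁ [IsCyclotomicExtension {15} ℚ K] (hζ : IsPrimitiveRoot ζ 15) {y : K} (R : ℚ[X])
    (hR : R.natDegree ≤ 7)
    (hkey : y * (ζ ^ 2 + 1) = aeval ζ R * (aeval ζ (derivative (cyclotomic 15 ℚ)))⁻¹ * ζ) :
    Algebra.trace ℚ K (y * (ζ + ζ⁻¹)) = R.coeff 7 := by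
  have hζ0 : ζ ≠ 0 := hζ.ne_zero (by norm_num)
  refine trace_of_key₀ hζ R hR (mul_right_cancel₀ hζ0 ?_)
  rw [mul_assoc, theta_mul_zeta hζ, hkey]

/-- `Tr_{K/ℚ}(y·θ^m) = coeff₇(R)` if `y(ζ² + 1)^m = R(ζ)Φ₁₅′(ζ)⁻¹·ζ^m` (`θ^m ζ^m = (ζ² + 1)^m`).
HFMARK [folklore] -/
theorem trace_of_key [IsCyclotomicExtension {15} ℚ K] (hζ : IsPrimitiveRoot ζ 15) {y : K} {m : ℕ} (R : ℚ[X])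
    (hR : R.natDegree ≤ 7)
    (hkey : y * (ζ ^ 2 + 1) ^ m = aeval ζ R * (aeval ζ (derivative (cyclotomic 15 ℚ)))⁻¹ * ζ ^ m) :
    Algebra.trace ℚ K (y * (ζ + ζ⁻¹) ^ m) = R.coeff 7 := by
  have hζ0 : ζ ≠ 0 := hζ.ne_zero (by norm_num)
  refine trace_of_key₀ hζ R hR (mul_right_cancel₀ (pow_ne_zero m hζ0) ?_)
  rw [mul_assoc, ← mul_pow, theta_mul_zeta hζ, hkey]

/-! ### §1 The principal-type form `E_ξ` for `K_d = ℚ(√−3)`: seven traces, the Hankel matrix, `det = −144` -/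

/-- `Tr(ζ′sθ^0) = 2` for `ζ′ = ξ = ζ³/Φ₁₅′(ζ)`, `s = √−3 = 1 + 2ζ⁵`, `θ = ζ + ζ⁻¹` (Euler evaluation). research route conditional on HC_CM; not a corollary; Q11.4-sentence-2 already refuted in dim ≥ 3. [folklore] -/
theorem trace_xi_sqrtNegThree_zero [IsCyclotomicExtension {15} ℚ K] (hζ : IsPrimitiveRoot ζ 15) :
    Algebra.trace ℚ K ((ζ ^ 3 * (aeval ζ (derivative (cyclotomic 15 ℚ)))⁻¹) * (1 + 2 * ζ ^ 5)) = 2 := by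
  have hΦ := cyc_fifteen hζ
  rw [trace_of_key₀ hζ (C (-2 : ℚ) + C (2 : ℚ) * X + C (-1 : ℚ) * X ^ 3 + C (2 : ℚ) * X ^ 4 + C (-2 : ℚ) * X ^ 5 +
      C (2 : ℚ) * X ^ 7) (by compute_degree) (by
    simp only [map_add, map_mul, map_pow, aeval_C, aeval_X, map_neg, eq_ratCast, Rat.cast_ofNat]
    linear_combination ((aeval ζ (derivative (cyclotomic 15 ℚ)))⁻¹ * (2)) * hΦ)]
  norm_num [coeff_X_pow, coeff_X, coeff_C]

/-- `Tr(ζ′sθ^1) = 4` for `ζ′ = ξ = ζ³/Φ₁₅′(ζ)`, `s = √−3 = 1 + 2ζ⁵`, `θ = ζ + ζ⁻¹` (Euler evaluation). research route conditional on HC_CM; not a corollary; Q11.4-sentence-2 already refuted in dim ≥ 3. [folklore] -/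
theorem trace_xi_sqrtNegThree_one [IsCyclotomicExtension {15} ℚ K] (hζ : IsPrimitiveRoot ζ 15) :
    Algebra.trace ℚ K ((ζ ^ 3 * (aeval ζ (derivative (cyclotomic 15 ℚ)))⁻¹) * (1 + 2 * ζ ^ 5) * (ζ + ζ⁻¹)) = 4 := by
  have hΦ := cyc_fifteen hζ
  rw [trace_of_key₁ hζ (C (-2 : ℚ) + C (3 : ℚ) * X ^ 2 + C (-2 : ℚ) * X ^ 3 + C (1 : ℚ) * X ^ 4 + C (-2 : ℚ) * X ^ 6 +
      C (4 : ℚ) * X ^ 7) (by compute_degree) (by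
    simp only [map_add, map_mul, map_pow, aeval_C, aeval_X, map_neg, eq_ratCast, Rat.cast_ofNat]
    linear_combination ((aeval ζ (derivative (cyclotomic 15 ℚ)))⁻¹ * (2 * ζ + 2 * ζ^2)) * hΦ)]
  norm_num [coeff_X_pow, coeff_X, coeff_C]

/-- `Tr(ζ′sθ^2) = 4` for `ζ′ = ξ = ζ³/Φ₁₅′(ζ)`, `s = √−3 = 1 + 2ζ⁵`, `θ = ζ + ζ⁻¹` (Euler evaluation). research route conditional on HC_CM; not a corollary; Q11.4-sentence-2 already refuted in dim ≥ 3. [folklore] -/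
theorem trace_xi_sqrtNegThree_two [IsCyclotomicExtension {15} ℚ K] (hζ : IsPrimitiveRoot ζ 15) :
    Algebra.trace ℚ K ((ζ ^ 3 * (aeval ζ (derivative (cyclotomic 15 ℚ)))⁻¹) * (1 + 2 * ζ ^ 5) * (ζ + ζ⁻¹) ^ 2) = 4 := by
  have hΦ := cyc_fifteen hζ
  rw [trace_of_key hζ (C (-6 : ℚ) + C (5 : ℚ) * X + C (-2 : ℚ) * X ^ 3 + C (4 : ℚ) * X ^ 4 + C (-5 : ℚ) * X ^ 5 +
      C (2 : ℚ) * X ^ 6 + C (4 : ℚ) * X ^ 7) (by compute_degree) (by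
    simp only [map_add, map_mul, map_pow, aeval_C, aeval_X, map_neg, eq_ratCast, Rat.cast_ofNat]
    linear_combination ((aeval ζ (derivative (cyclotomic 15 ℚ)))⁻¹ * (6 * ζ^2 + 2 * ζ^3 + 2 * ζ^4)) * hΦ)]
  norm_num [coeff_X_pow, coeff_X, coeff_C]

/-- `Tr(ζ′sθ^3) = 12` for `ζ′ = ξ = ζ³/Φ₁₅′(ζ)`, `s = √−3 = 1 + 2ζ⁵`, `θ = ζ + ζ⁻¹` (Euler evaluation). research route conditional on HC_CM; not a corollary; Q11.4-sentence-2 already refuted in dim ≥ 3. [folklore] -/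
theorem trace_xi_sqrtNegThree_three [IsCyclotomicExtension {15} ℚ K] (hζ : IsPrimitiveRoot ζ 15) :
    Algebra.trace ℚ K ((ζ ^ 3 * (aeval ζ (derivative (cyclotomic 15 ℚ)))⁻¹) * (1 + 2 * ζ ^ 5) * (ζ + ζ⁻¹) ^ 3) = 12 := by
  have hΦ := cyc_fifteen hζ
  rw [trace_of_key hζ (C (-5 : ℚ) + C (-2 : ℚ) * X + C (9 : ℚ) * X ^ 2 + C (-6 : ℚ) * X ^ 3 + C (3 : ℚ) * X ^ 4 +
      C (2 : ℚ) * X ^ 5 + C (-7 : ℚ) * X ^ 6 + C (12 : ℚ) * X ^ 7) (by compute_degree) (by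
    simp only [map_add, map_mul, map_pow, aeval_C, aeval_X, map_neg, eq_ratCast, Rat.cast_ofNat]
    linear_combination ((aeval ζ (derivative (cyclotomic 15 ℚ)))⁻¹ * (6 * ζ^3 + 8 * ζ^4 + 2 * ζ^5 + 2 * ζ^6)) * hΦ)]
  norm_num [coeff_X_pow, coeff_X, coeff_C]

/-- `Tr(ζ′sθ^4) = 10` for `ζ′ = ξ = ζ³/Φ₁₅′(ζ)`, `s = √−3 = 1 + 2ζ⁵`, `θ = ζ + ζ⁻¹` (Euler evaluation). research route conditional on HC_CM; not a corollary; Q11.4-sentence-2 already refuted in dim ≥ 3. [folklore] -/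
theorem trace_xi_sqrtNegThree_four [IsCyclotomicExtension {15} ℚ K] (hζ : IsPrimitiveRoot ζ 15) :
    Algebra.trace ℚ K ((ζ ^ 3 * (aeval ζ (derivative (cyclotomic 15 ℚ)))⁻¹) * (1 + 2 * ζ ^ 5) * (ζ + ζ⁻¹) ^ 4) = 10 := by
  have h15 : ζ ^ 15 = 1 := hζ.pow_eq_one
  have hΦ := cyc_fifteen hζ
  rw [trace_of_key hζ (C (-19 : ℚ) + C (16 : ℚ) * X + C (-3 : ℚ) * X ^ 2 + C (-5 : ℚ) * X ^ 3 + C (13 : ℚ) * X ^ 4 +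
      C (-16 : ℚ) * X ^ 5 + C (9 : ℚ) * X ^ 6 + C (10 : ℚ) * X ^ 7) (by compute_degree) (by
    simp only [map_add, map_mul, map_pow, aeval_C, aeval_X, map_neg, eq_ratCast, Rat.cast_ofNat]
    linear_combination ((aeval ζ (derivative (cyclotomic 15 ℚ)))⁻¹ * (2 * ζ + 2 * ζ^2 + 3 * ζ^3 + 20 * ζ^4 + 8 * ζ^5 +
        8 * ζ^6)) * hΦ +
      ((aeval ζ (derivative (cyclotomic 15 ℚ)))⁻¹ * (2 * ζ)) * h15)]
  norm_num [coeff_X_pow, coeff_X, coeff_C]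

/-- `Tr(ζ′sθ^5) = 38` for `ζ′ = ξ = ζ³/Φ₁₅′(ζ)`, `s = √−3 = 1 + 2ζ⁵`, `θ = ζ + ζ⁻¹` (Euler evaluation). research route conditional on HC_CM; not a corollary; Q11.4-sentence-2 already refuted in dim ≥ 3. [folklore] -/
theorem trace_xi_sqrtNegThree_five [IsCyclotomicExtension {15} ℚ K] (hζ : IsPrimitiveRoot ζ 15) :
    Algebra.trace ℚ K ((ζ ^ 3 * (aeval ζ (derivative (cyclotomic 15 ℚ)))⁻¹) * (1 + 2 * ζ ^ 5) * (ζ + ζ⁻¹) ^ 5) = 38 := by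
  have h15 : ζ ^ 15 = 1 := hζ.pow_eq_one
  have hΦ := cyc_fifteen hζ
  rw [trace_of_key hζ (C (-13 : ℚ) + C (-12 : ℚ) * X + C (30 : ℚ) * X ^ 2 + C (-19 : ℚ) * X ^ 3 + C (8 : ℚ) * X ^ 4 +
      C (12 : ℚ) * X ^ 5 + C (-25 : ℚ) * X ^ 6 + C (38 : ℚ) * X ^ 7) (by compute_degree) (by
    simp only [map_add, map_mul, map_pow, aeval_C, aeval_X, map_neg, eq_ratCast, Rat.cast_ofNat]
    linear_combination ((aeval ζ (derivative (cyclotomic 15 ℚ)))⁻¹ * (10 * ζ + 10 * ζ^2 + 13 * ζ^3 + 3 * ζ^4 + 21 * ζ^5 +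
        20 * ζ^6)) * hΦ +
      ((aeval ζ (derivative (cyclotomic 15 ℚ)))⁻¹ * (10 * ζ + 2 * ζ^3)) * h15)]
  norm_num [coeff_X_pow, coeff_X, coeff_C]

/-- `Tr(ζ′sθ^6) = 26` for `ζ′ = ξ = ζ³/Φ₁₅′(ζ)`, `s = √−3 = 1 + 2ζ⁵`, `θ = ζ + ζ⁻¹` (Euler evaluation). research route conditional on HC_CM; not a corollary; Q11.4-sentence-2 already refuted in dim ≥ 3. [folklore] -/
theorem trace_xi_sqrtNegThree_six [IsCyclotomicExtension {15} ℚ K] (hζ : IsPrimitiveRoot ζ 15) :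
    Algebra.trace ℚ K ((ζ ^ 3 * (aeval ζ (derivative (cyclotomic 15 ℚ)))⁻¹) * (1 + 2 * ζ ^ 5) * (ζ + ζ⁻¹) ^ 6) = 26 := by
  have h15 : ζ ^ 15 = 1 := hζ.pow_eq_one
  have hΦ := cyc_fifteen hζ
  rw [trace_of_key hζ (C (-63 : ℚ) + C (55 : ℚ) * X + C (-18 : ℚ) * X ^ 2 + C (-13 : ℚ) * X ^ 3 + C (44 : ℚ) * X ^ 4 +
      C (-55 : ℚ) * X ^ 5 + C (37 : ℚ) * X ^ 6 + C (26 : ℚ) * X ^ 7) (by compute_degree) (by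
    simp only [map_add, map_mul, map_pow, aeval_C, aeval_X, map_neg, eq_ratCast, Rat.cast_ofNat]
    linear_combination ((aeval ζ (derivative (cyclotomic 15 ℚ)))⁻¹ * (1 + 31 * ζ + 31 * ζ^2 + 43 * ζ^3 + 13 * ζ^4 + 20 * ζ^5 +
        40 * ζ^6)) * hΦ +
      ((aeval ζ (derivative (cyclotomic 15 ℚ)))⁻¹ * (1 + 30 * ζ + 12 * ζ^3 + 2 * ζ^5)) * h15)]
  norm_num [coeff_X_pow, coeff_X, coeff_C]

/-- **The Gram datum `a` of `(E_ζ′, s)` in the real frame `θ^i` (`i < 4`)** for `ζ′ = ξ = ζ³/Φ₁₅′(ζ)` (principal type (1)),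
`s = √−3 = 1 + 2ζ⁵`: the integer Hankel matrix `(−Tr(ζ′sθ^{i+j}))ᵢⱼ` (and `b = 0`, part 82 `hb_eq_zero`).
research route conditional on HC_CM; not a corollary; Q11.4-sentence-2 already refuted in dim ≥ 3. [cite: vanGeemen1994HodgeAV, Lemma 5.2 (2)–(3)] -/
theorem realPart_xi_sqrtNegThree [IsCyclotomicExtension {15} ℚ K] [IsCMField K] (hζ : IsPrimitiveRoot ζ 15)
    {x : Fin 4 → K} (hx : ∀ i, x i = (ζ + ζ⁻¹) ^ (i : ℕ)) {a : Matrix (Fin 4) (Fin 4) ℚ}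
    (ha : ∀ i j, a i j = Algebra.trace ℚ K ((ζ ^ 3 * (aeval ζ (derivative (cyclotomic 15 ℚ)))⁻¹) * x i * IsCMField.complexConj K ((1 + 2 * ζ ^ 5) * x j))) :
    a = !![-2, -4, -4, -12; -4, -4, -12, -10; -4, -12, -10, -38; -12, -10, -38, -26] := by
  rw [ha_eq (complexConj_sqrtNegThree hζ) (complexConj_thetaFrame hζ hx) ha]
  ext i j
  simp only [Matrix.of_apply, hx, ← pow_add]
  fin_cases i <;> fin_cases j <;> simp [trace_xi_sqrtNegThree_zero hζ, trace_xi_sqrtNegThree_one hζ, trace_xi_sqrtNegThree_two hζ, trace_xi_sqrtNegThree_three hζ, trace_xi_sqrtNegThree_four hζ, trace_xi_sqrtNegThree_five hζ, trace_xi_sqrtNegThree_six hζ]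

/-- **`det a = -144`** for `ζ′ = ξ = ζ³/Φ₁₅′(ζ)`, `s = √−3 = 1 + 2ζ⁵` (frame `θ^i`).
research route conditional on HC_CM; not a corollary; Q11.4-sentence-2 already refuted in dim ≥ 3. [cite: vanGeemen1994HodgeAV, Lemma 5.2 (3)] -/
theorem det_realPart_xi_sqrtNegThree [IsCyclotomicExtension {15} ℚ K] [IsCMField K] (hζ : IsPrimitiveRoot ζ 15)
    {x : Fin 4 → K} (hx : ∀ i, x i = (ζ + ζ⁻¹) ^ (i : ℕ)) {a : Matrix (Fin 4) (Fin 4) ℚ}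
    (ha : ∀ i j, a i j = Algebra.trace ℚ K ((ζ ^ 3 * (aeval ζ (derivative (cyclotomic 15 ℚ)))⁻¹) * x i * IsCMField.complexConj K ((1 + 2 * ζ ^ 5) * x j))) :
    a.det = -144 := by
  rw [realPart_xi_sqrtNegThree hζ hx ha]
  simp [Matrix.det_succ_row_zero, Fin.sum_univ_succ, Fin.succAbove, Matrix.submatrix]
  norm_num

/-! ### §3 `1, θ, θ², θ³` is a `ℚ`-basis of `K⁺ = ℚ(ζ₁₅)⁺` -/

/-- `[ℚ(ζ₁₅)⁺ : ℚ] = 4`. [folklore] -/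
theorem finrank_realSubfield [IsCyclotomicExtension {15} ℚ K] [IsCMField K] :
    finrank ℚ (maximalRealSubfield K) = 4 := by
  have h1 : finrank ℚ K = 8 := by
    rw [IsCyclotomicExtension.finrank K (cyclotomic.irreducible_rat (by norm_num : 0 < 15))]; decide
  have h2 := Module.finrank_mul_finrank ℚ (maximalRealSubfield K) K
  rw [Algebra.IsQuadraticExtension.finrank_eq_two (maximalRealSubfield K) K, h1] at h2
  omega

/-- **`1, θ, θ², θ³` are `ℚ`-linearly independent in `K⁺`**: a relation `Σ cₖ θ^k = 0`, multiplied by `ξ s₃ θ^m` and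
traced, gives `Σₖ cₖ Tr(ξ s₃ θ^{m+k}) = 0` for `m ≤ 3` — the Hankel system of §1, of determinant `−144 ≠ 0`.
research route conditional on HC_CM; not a corollary; Q11.4-sentence-2 already refuted in dim ≥ 3. [folklore] -/
theorem linearIndependent_thetaPow [IsCyclotomicExtension {15} ℚ K] [IsCMField K] (hζ : IsPrimitiveRoot ζ 15)
    {ω : Fin 4 → maximalRealSubfield K} (hω : ∀ i, (ω i : K) = (ζ + ζ⁻¹) ^ (i : ℕ)) : LinearIndependent ℚ ω := by
  rw [Fintype.linearIndependent_iff]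
  intro c hc
  have hcK : ∑ i : Fin 4, (c i : K) * (ζ + ζ⁻¹) ^ (i : ℕ) = 0 := by
    have h := congrArg (fun y : maximalRealSubfield K => (y : K)) hc
    simp only [ZeroMemClass.coe_zero] at h
    rw [← h]
    push_cast
    refine Finset.sum_congr rfl fun i _ => ?_
    rw [Rat.smul_def, hω i]
  have E : ∀ m : ℕ, ∑ i : Fin 4, c i * Algebra.trace ℚ K ((ζ ^ 3 * (aeval ζ (derivative (cyclotomic 15 ℚ)))⁻¹) * (1 + 2 * ζ ^ 5) *
      (ζ + ζ⁻¹) ^ (m + (i : ℕ))) = 0 := by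
    intro m
    have h := congrArg (fun y => Algebra.trace ℚ K ((ζ ^ 3 * (aeval ζ (derivative (cyclotomic 15 ℚ)))⁻¹) * (1 + 2 * ζ ^ 5) * (ζ + ζ⁻¹) ^ m * y)) hcK
    simp only [mul_zero, map_zero, Finset.mul_sum, map_sum] at h
    rw [← h]
    refine Finset.sum_congr rfl fun i _ => ?_
    rw [show (ζ ^ 3 * (aeval ζ (derivative (cyclotomic 15 ℚ)))⁻¹) * (1 + 2 * ζ ^ 5) * (ζ + ζ⁻¹) ^ m *
        ((c i : K) * (ζ + ζ⁻¹) ^ (i : ℕ)) = (c i) • ((ζ ^ 3 * (aeval ζ (derivative (cyclotomic 15 ℚ)))⁻¹) * (1 + 2 * ζ ^ 5) *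
        (ζ + ζ⁻¹) ^ (m + (i : ℕ))) by rw [Rat.smul_def, pow_add]; ring, map_smul, smul_eq_mul]
  have e0 := E 0
  have e1 := E 1
  have e2 := E 2
  have e3 := E 3
  simp only [Fin.sum_univ_four, Fin.isValue, Fin.val_zero, Fin.val_one, Fin.val_two, show ((3 : Fin 4) : ℕ) = 3 from rfl,
    Nat.reduceAdd, zero_add, add_zero, pow_zero, mul_one, pow_one, trace_xi_sqrtNegThree_zero hζ, trace_xi_sqrtNegThree_one hζ, trace_xi_sqrtNegThree_two hζ, trace_xi_sqrtNegThree_three hζ, trace_xi_sqrtNegThree_four hζ, trace_xi_sqrtNegThree_five hζ, trace_xi_sqrtNegThree_six hζ] at e0 e1 e2 e3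
  have c0 : c 0 = 0 := by linear_combination ((5 : ℚ) / 2) * e0 + ((-4 : ℚ) / 3) * e1 + ((-2 : ℚ) / 3) * e2 + ((1 : ℚ) / 3) * e3
  have c1 : c 1 = 0 := by linear_combination ((-4 : ℚ) / 3) * e0 + (4 : ℚ) * e1 + ((1 : ℚ) / 6) * e2 + ((-7 : ℚ) / 6) * e3
  have c2 : c 2 = 0 := by linear_combination ((-2 : ℚ) / 3) * e0 + ((1 : ℚ) / 6) * e1 + ((1 : ℚ) / 6) * e2
  have c3 : c 3 = 0 := by linear_combination ((1 : ℚ) / 3) * e0 + ((-7 : ℚ) / 6) * e1 + ((1 : ℚ) / 3) * e3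
  intro i
  fin_cases i
  · exact c0
  · exact c1
  · exact c2
  · exact c3

/-- **A `ℚ`-basis `ωb` of `K⁺ = ℚ(ζ₁₅)⁺` with `ωb i = θ^i`** (`i < 4`). [folklore] -/
theorem exists_basis_thetaPow [IsCyclotomicExtension {15} ℚ K] [IsCMField K] (hζ : IsPrimitiveRoot ζ 15) :
    ∃ ωb : Basis (Fin 4) ℚ (maximalRealSubfield K), ∀ i, (ωb i : K) = (ζ + ζ⁻¹) ^ (i : ℕ) := by
  let θ' : maximalRealSubfield K :=
    ⟨ζ + ζ⁻¹, (IsCMField.complexConj_eq_self_iff K (ζ + ζ⁻¹)).mp (complexConj_theta hζ)⟩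
  let ω : Fin 4 → maximalRealSubfield K := fun i => θ' ^ (i : ℕ)
  have hω : ∀ i, (ω i : K) = (ζ + ζ⁻¹) ^ (i : ℕ) := fun i => by simp [ω, θ']
  have hli := linearIndependent_thetaPow hζ hω
  have hcard : Fintype.card (Fin 4) = finrank ℚ (maximalRealSubfield K) := by
    rw [Fintype.card_fin, finrank_realSubfield]
  exact ⟨basisOfLinearIndependentOfCardEqFinrank hli hcard, fun i => by
    rw [coe_basisOfLinearIndependentOfCardEqFinrank]; exact hω i⟩

/-! ### §4 Every principal-type parameter gives the same determinant (THEOREM L (i) at `15`), and its class -/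

/-- **For EVERY skew `ζ′` of PRINCIPAL type on `ℤ[ζ₁₅]` (`IsOfType 1 ζ′ ⊤`; `ζ′ = uξ`, `u` a real unit, `N(u) = 1`
by THEOREM L (i) at `15`) the Gram determinant of `(E_ζ′, s₃)` in the frame `θ^i` is `-144`** — in
particular for every `Φ` and every `Φ`-positive such `ζ′`; `(−1)² det a < 0`, the wrong sign for Weil signature `(2,2)`
[vG94 Lemma 5.2 (4)] — cf. the census NO row (part 75 `not_exists_principal_fifteen_…`).
research route conditional on HC_CM; not a corollary; Q11.4-sentence-2 already refuted in dim ≥ 3. [cite: vanGeemen1994HodgeAV, Lemma 5.2 (3)–(4)] [cite: Shimura1998, §14.3 Prop. 5, p. 104] -/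
theorem det_realPart_principal_sqrtNegThree [IsCyclotomicExtension {15} ℚ K] [IsCMField K]
    (hζ : IsPrimitiveRoot ζ 15) {ζ' : K} (hζ' : IsCMField.complexConj K ζ' = -ζ')
    (hT : CMTypeLattice.IsOfType (1 : (FractionalIdeal (𝓞 K)⁰ K)ˣ) ζ' ⊤)
    {x : Fin 4 → K} (hx : ∀ i, x i = (ζ + ζ⁻¹) ^ (i : ℕ)) {a : Matrix (Fin 4) (Fin 4) ℚ}
    (ha : ∀ i j, a i j = Algebra.trace ℚ K (ζ' * x i * IsCMField.complexConj K ((1 + 2 * ζ ^ 5) * x j))) :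
    a.det = -144 := by
  obtain ⟨ωb, hωb⟩ := exists_basis_thetaPow hζ
  have hx' : ∀ i, x i = (ωb i : K) := fun i => (hx i).trans (hωb i).symm
  rw [det_realPart_eq_of_isOfType ωb (complexConj_sqrtNegThree hζ) hx' (norm_realUnits_pos_fifteen hζ)
    (complexConj_xi_fifteen hζ) (xi_ne_zero hζ 3) hζ' (isOfType_one_xi_top hζ 3) hT (fun i j => rfl) ha]
  exact det_realPart_xi_sqrtNegThree hζ hx (fun i j => rfl)

/-- **The class of `-144 = −12²` in `ℚˣ/Nm(ℚ(s√−3)ˣ)` is `[−1]`, NOT the split class `[1]`** (`−1 < 0` is not a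
norm from an imaginary quadratic field): were `E_ζ′` a polarisation of a Weil-type CM fourfold this would be its
component — it is not, by the sign (docstring above).
research route conditional on HC_CM; not a corollary; Q11.4-sentence-2 already refuted in dim ≥ 3. [cite: vanGeemen1994HodgeAV, Lemma 5.2 (3)–(4) and (5.4.1)] -/
theorem mk0_det_principal_sqrtNegThree :
    (QuotientGroup.mk (Units.mk0 (-144 : ℚ) (by norm_num)) : weilNormResidueGroup 3) =
        QuotientGroup.mk (Units.mk0 (-1 : ℚ) (by norm_num)) ∧
      (QuotientGroup.mk (Units.mk0 (-1 : ℚ) (by norm_num)) : weilNormResidueGroup 3) ≠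
        splitDiscriminantClass 2 3 := by
  constructor
  · rw [QuotientGroup.eq]
    have e : (Units.mk0 (-144 : ℚ) (by norm_num))⁻¹ * Units.mk0 (-1 : ℚ) (by norm_num) =
        Units.mk0 ((1 / 144) : ℚ) (by norm_num) := Units.ext (by norm_num)
    rw [e]
    exact mem_normUnitsSubgroup_of_sq_add_mul_sq _ ((1 / 12) : ℚ) 0 (by norm_num)
  · refine mk_ne_split_of_even (by decide) _ (not_mem_normUnitsSubgroup_of_not_exists _ ?_)
    rintro ⟨x, y, h⟩
    nlinarith [sq_nonneg x, sq_nonneg y]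

end Summit.HodgeConjecture.Ring2WeilCoverage.WeilGramLevel15

end
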